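import Summits.NavierStokesRegularity.NavierStokesRegularity.Theorems.TypeICertificateLadderTargetTypeIZoom
import Summits.NavierStokesRegularity.NavierStokesRegularity.Theorems.ExtremiserTransienceNearExtremalTransiencePerFlowMemberSelectionStubZoomPackage
import HarnessLib

/-!
# Route `ExtremiserTransience`, crux `NearExtremalTransiencePerFlow` (stmt-NavierStokesRegularity-26567) —
# LINE g9-β «filament selection» §2e, stub T2′ `stub_zoomPackageFlow`, part 1: PRELIMINARIES

`--supports stmt-NavierStokesRegularity-26567`.  Prover seat ns-net-p2 (g6).  Two preliminaries of the flow-level zoom package: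
* `typeI_pinning_eventually` — the Type-I PINNING of the height bound at near-efficient late times of a violator flow,
  `(T − t n)(Mb n)² ≤ 4C²ν` eventually (universality of `κ⋆` at the Type-I height; the computation inside the landed
  `MemberSelection.stub_zoomPackage`, isolated);
* `unitViscosity_oseen_rate` — the viscosity normalisation `v(s', x) = ν⁻¹ u(s'/ν, x)` with its EXPLICIT formula (the pattern of
  `typeIZoom_unit_viscosity`, which hides `v` behind an existential): `v` is classical at unit viscosity on `[0, νT)`, satisfies the
  Oseen integral equation between all pairs of positive times (`typeIZoom_oseen_pairs`), and keeps the rate `√(νT − s')‖v‖ ≤ C`.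
HONEST FRAMING: bookkeeping about hypothetical Type-I singular flows; nothing about Navier–Stokes regularity or blow-up is proved; no
summit is proved by a line. [cite: KochNadirashviliSereginSverak2009, §4 (i) and proof of Thm 6.2 (arXiv:0709.3599 pp. 8, 13)]
-/

noncomputable section

open scoped Topology InnerProductSpace RealInnerProductSpace ENNReal ContDiff
open MeasureTheory Filter Set Metric Function
open Literature.Analysis Literature.Analysis.FluidPDE
open Summit.NavierStokesRegularity.NavierStokesRegularity.Theorems.DepletionLadder.KStar.HalfSpace
open Summit.NavierStokesRegularity.NavierStokesRegularity.Theorems.NearExtremalTransiencePerFlow.ZoneTransversality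
open Summit.NavierStokesRegularity.NavierStokesRegularity.Theorems.NearExtremalTransiencePerFlow.MemberSelection

namespace Summit.NavierStokesRegularity.NavierStokesRegularity.Theorems

set_option linter.dupNamespace false

namespace NearExtremalTransiencePerFlow.FilamentSelection

/-! ### Step 1: the Type-I pinning of the height bound at near-efficient late times -/

/-- **Type-I pinning** (as inside the landed `stub_zoomPackage`): for a violator flow with efficient-times data,
`(T − t n)(Mb n)² ≤ 4C²ν` for all late `n` — once `t n` is in the rate window and `ε n < κ⋆/2`, universality of `κ⋆` at the
Type-I height `C√ν/√(T − t n)` forces `Mb n ≤ 2C√ν/√(T − t n)`.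
[cite: KochNadirashviliSereginSverak2009, proof of Thm 6.2 (arXiv:0709.3599 p. 13)] -/
theorem typeI_pinning_eventually {C ν T : ℝ} {u : ℝ → EuclideanSpace ℝ (Fin 3) → EuclideanSpace ℝ (Fin 3)}
    {p : ℝ → EuclideanSpace ℝ (Fin 3) → ℝ} (hV : IsViolator C ν T u p) {Θ : ℝ} {t Mb ε : ℕ → ℝ}
    (hD : EfficientTimesData ν T u Θ t Mb ε) :
    ∀ᶠ n in atTop, (T - t n) * Mb n ^ 2 ≤ 4 * C ^ 2 * ν := by
  -- adapted from the landed `MemberSelection.stub_zoomPackage` (same computation)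
  obtain ⟨hC, hν, hT, hsol, hLH, hdec, hrate, -, -⟩ := hV
  obtain ⟨ht, htT, hε, hMbpos, -, hpos, heff, -⟩ := hD
  have hTt : ∀ n, 0 < T - t n := fun n => sub_pos.2 (ht n).2
  obtain ⟨tstar, htstar, hsub⟩ := mem_nhdsLT_iff_exists_Ioo_subset.1 hrate
  have htstarT : tstar < T := htstar
  have hk : 0 < kStar := kStar_pos
  have h1 : ∀ᶠ n in atTop, t n ∈ Set.Ioi tstar := htT (Ioi_mem_nhds htstarT)
  have h2 : ∀ᶠ n in atTop, ε n ∈ Set.Iio (kStar / 2) := hε (Iio_mem_nhds (by positivity))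
  have huniv := DepletionLadder.flowwise_of_universal DepletionLadder.sharpDepletion_is_universal hν hT hsol hLH hdec
  filter_upwards [h1, h2] with n htn hεn
  have htn' : tstar < t n := htn
  have hεn' : ε n < kStar / 2 := hεn
  have hsq : 0 < Real.sqrt (T - t n) := Real.sqrt_pos.2 (hTt n)
  have hN : ∀ x, ‖u (t n) x‖ ≤ C * Real.sqrt ν / Real.sqrt (T - t n) := fun x => by
    rw [le_div_iff₀ hsq, mul_comm]; exact hsub ⟨htn', (ht n).2⟩ x
  have hJ := huniv (t n) (ht n) _ hN
  have h3 : (kStar - ε n) * Mb n ≤ kStar * (C * Real.sqrt ν / Real.sqrt (T - t n)) := by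
    have h := (heff n).trans hJ
    set D : ℝ := Real.sqrt (∫ x, ‖curl (u (t n)) x‖ ^ 2) *
      Real.sqrt (∫ x, frobeniusNormSq (fderiv ℝ (curl (u (t n))) x)) with hDdef
    have h' : (kStar - ε n) * Mb n * D ≤ kStar * (C * Real.sqrt ν / Real.sqrt (T - t n)) * D := by
      calc (kStar - ε n) * Mb n * D
          = (kStar - ε n) * Mb n * Real.sqrt (∫ x, ‖curl (u (t n)) x‖ ^ 2) *
              Real.sqrt (∫ x, frobeniusNormSq (fderiv ℝ (curl (u (t n))) x)) := by rw [hDdef]; ring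
        _ ≤ kStar * (C * Real.sqrt ν / Real.sqrt (T - t n)) * Real.sqrt (∫ x, ‖curl (u (t n)) x‖ ^ 2) *
              Real.sqrt (∫ x, frobeniusNormSq (fderiv ℝ (curl (u (t n))) x)) := h
        _ = kStar * (C * Real.sqrt ν / Real.sqrt (T - t n)) * D := by rw [hDdef]; ring
    exact le_of_mul_le_mul_right h' (hpos n)
  have h4 : kStar / 2 * Mb n ≤ kStar * (C * Real.sqrt ν / Real.sqrt (T - t n)) :=
    le_trans (mul_le_mul_of_nonneg_right (by linarith) (hMbpos n).le) h3
  have h5 : Mb n * Real.sqrt (T - t n) ≤ 2 * C * Real.sqrt ν := by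
    have := mul_le_mul_of_nonneg_right h4 hsq.le
    have e : kStar * (C * Real.sqrt ν / Real.sqrt (T - t n)) * Real.sqrt (T - t n) = kStar * C * Real.sqrt ν := by
      field_simp
    nlinarith [e ▸ this]
  have h6 := pow_le_pow_left₀ (mul_nonneg (hMbpos n).le hsq.le) h5 2
  rw [mul_pow, mul_pow, mul_pow, Real.sq_sqrt (hTt n).le, Real.sq_sqrt hν.le] at h6
  linarith

/-! ### The viscosity normalisation with an explicit formula -/

/-- **Viscosity normalisation, explicit form.**  For `(u, p)` classical on `[0,T) × ℝ³` (viscosity `ν > 0`), Leray–Hopf from its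
rapidly decaying datum, with the eventual rate `√(T − t)‖u t x‖ ≤ C√ν`, the field `v = timeRescale ν⁻¹ ν⁻¹ u`, i.e.
`v s' x = ν⁻¹ • u (ν⁻¹ s') x`, with pressure `timeRescale ν⁻¹ ν⁻² p`, is classical at unit viscosity on `[0, νT)`, satisfies the
Oseen integral equation between all pairs of times `0 < s₁ < t₁ < νT`, and obeys `√(νT − s')‖v s' x‖ ≤ C` eventually as
`s' ↑ νT` (Tao 2013 footnote 3; KNSS 2009 §4 (i)). [cite: KochNadirashviliSereginSverak2009, §4 (i) and Remark 4.1 (arXiv:0709.3599 p. 8)] -/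
theorem unitViscosity_oseen_rate {C ν T : ℝ} (hν : 0 < ν) (hT : 0 < T)
    {u : ℝ → EuclideanSpace ℝ (Fin 3) → EuclideanSpace ℝ (Fin 3)} {p : ℝ → EuclideanSpace ℝ (Fin 3) → ℝ}
    (hsol : IsClassicalNSSolutionOn (Set.Ico 0 T) ν 0 u p) (hLH : IsLerayHopfOn T ν 0 (u 0) u)
    (hdec : HasRapidSpatialDecay (u 0))
    (hrate : ∀ᶠ t in 𝓝[<] T, ∀ x, Real.sqrt (T - t) * ‖u t x‖ ≤ C * Real.sqrt ν) :
    IsClassicalNSSolutionOn (Set.Ico 0 (ν * T)) 1 0 (timeRescale ν⁻¹ ν⁻¹ u) (timeRescale ν⁻¹ (ν⁻¹ ^ 2) p) ∧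
      (∀ s₁ t₁ : ℝ, 0 < s₁ → s₁ < t₁ → t₁ < ν * T → ∀ X,
        timeRescale ν⁻¹ ν⁻¹ u t₁ X =
          UnboundedOperators.heatExtension (timeRescale ν⁻¹ ν⁻¹ u s₁) (t₁ - s₁) X -
            oseenDuhamel 1 s₁ (timeRescale ν⁻¹ ν⁻¹ u) (timeRescale ν⁻¹ ν⁻¹ u) t₁ X) ∧
      (∀ᶠ s' in 𝓝[<] (ν * T), ∀ x, Real.sqrt (ν * T - s') * ‖timeRescale ν⁻¹ ν⁻¹ u s' x‖ ≤ C) := by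
  -- adapted from `typeIZoom_unit_viscosity` (pattern of `Cruxes/Target/Disproof.lean` §6)
  have hν0 : ν ≠ 0 := hν.ne'
  have hνi : 0 < ν⁻¹ := inv_pos.2 hν
  have hνT : 0 < ν * T := mul_pos hν hT
  set v : ℝ → EuclideanSpace ℝ (Fin 3) → EuclideanSpace ℝ (Fin 3) := timeRescale ν⁻¹ ν⁻¹ u with hv
  set π : ℝ → EuclideanSpace ℝ (Fin 3) → ℝ := timeRescale ν⁻¹ (ν⁻¹ ^ 2) p with hπ
  have hvapp : ∀ s' x, v s' x = ν⁻¹ • u (ν⁻¹ * s') x := fun _ _ => rfl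
  have hmaps : MapsTo (fun s' => ν⁻¹ * s') (Ico 0 (ν * T)) (Ico 0 T) := by
    intro s' hs'
    refine ⟨mul_nonneg hνi.le hs'.1, ?_⟩
    calc ν⁻¹ * s' < ν⁻¹ * (ν * T) := mul_lt_mul_of_pos_left hs'.2 hνi
      _ = T := by rw [← mul_assoc, inv_mul_cancel₀ hν0, one_mul]
  have hclv : IsClassicalNSSolutionOn (Ico 0 (ν * T)) 1 0 v π := by
    have h := hsol.viscosityRescale_set hν0 hmaps (uniqueDiffOn_Ico 0 (ν * T))
    rwa [timeRescale_zero_force] at h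
  have hv0 : ν⁻¹ • u 0 = v 0 := by
    funext x
    simp [hv]
  have hLHv : IsLerayHopfOn (ν * T) 1 0 (v 0) v := by
    have h := hLH.viscosityRescale hνi
    have e1 : T / ν⁻¹ = ν * T := by rw [div_inv_eq_mul, mul_comm]
    rwa [e1, inv_mul_cancel₀ hν0, timeRescale_zero_force, hv0] at h
  have hdecv : HasRapidSpatialDecay (v 0) := by
    rw [← hv0]
    exact SereginSverak2002_pressureOneSidedBound.hasRapidSpatialDecay_const_smul
      (hsol.contDiff_velocity ⟨le_rfl, hT⟩) hdec ν⁻¹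
  have hratev : ∀ᶠ s' in 𝓝[<] (ν * T), ∀ x, Real.sqrt (ν * T - s') * ‖v s' x‖ ≤ C := by
    have htc : Tendsto (fun s' : ℝ => ν⁻¹ * s') (𝓝[<] (ν * T)) (𝓝[<] T) := by
      have := Target.Negative.tendsto_const_mul_nhdsLT (T := T) hνi
      rwa [inv_inv] at this
    filter_upwards [htc.eventually hrate, self_mem_nhdsWithin] with s' hs' hsT x
    have hsT' : s' < ν * T := hsT
    have e : T - ν⁻¹ * s' = ν⁻¹ * (ν * T - s') := by field_simp
    have hsq : Real.sqrt (T - ν⁻¹ * s') = (Real.sqrt ν)⁻¹ * Real.sqrt (ν * T - s') := by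
      rw [e, Real.sqrt_mul hνi.le, Real.sqrt_inv]
    have hb := hs' x
    have hsν : 0 < Real.sqrt ν := Real.sqrt_pos.2 hν
    have hsνsq : Real.sqrt ν * Real.sqrt ν = ν := Real.mul_self_sqrt hν.le
    rw [hvapp, norm_smul, Real.norm_eq_abs, abs_of_pos hνi]
    rw [hsq] at hb
    have key : Real.sqrt (ν * T - s') * ‖u (ν⁻¹ * s') x‖ ≤ C * ν := by
      have h2 := mul_le_mul_of_nonneg_left hb hsν.le
      rw [← mul_assoc, ← mul_assoc, mul_inv_cancel₀ hsν.ne', one_mul] at h2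
      calc Real.sqrt (ν * T - s') * ‖u (ν⁻¹ * s') x‖ ≤ Real.sqrt ν * (C * Real.sqrt ν) := h2
        _ = C * (Real.sqrt ν * Real.sqrt ν) := by ring
        _ = C * ν := by rw [hsνsq]
    calc Real.sqrt (ν * T - s') * (ν⁻¹ * ‖u (ν⁻¹ * s') x‖)
        = ν⁻¹ * (Real.sqrt (ν * T - s') * ‖u (ν⁻¹ * s') x‖) := by ring
      _ ≤ ν⁻¹ * (C * ν) := mul_le_mul_of_nonneg_left key hνi.le
      _ = C := by field_simp
  -- the Oseen equation between all pairs of positive times of `v`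
  have hoseen : ∀ s₁ t₁ : ℝ, 0 < s₁ → s₁ < t₁ → t₁ < ν * T → ∀ X,
      v t₁ X = UnboundedOperators.heatExtension (v s₁) (t₁ - s₁) X - oseenDuhamel 1 s₁ v v t₁ X := by
    intro s₁ t₁ hs₁ hst ht₁ X
    have h := typeIZoom_oseen_pairs 1 (ν * T) v π one_pos hνT hclv hLHv hdecv s₁ t₁ hs₁ hst ht₁ X
    rwa [one_mul] at h
  exact ⟨hclv, hoseen, hratev⟩

end NearExtremalTransiencePerFlow.FilamentSelection

end Summit.NavierStokesRegularity.NavierStokesRegularity.Theorems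

end
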